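import Summits.BirchSwinnertonDyer.BirchSwinnertonDyer.Theorems.GenusKolyvaginAtTwoTorsionCellGenusDepthTwistEigen
import HarnessLib

/-!
# LINE 49 «full_vertex» — EIGENVECTORS ARE TWIST POINTS at the quadratic layer (`k = 1`): the converse of `…GenusDepthTwistEigen`

Crux R″ `RankOneTwoTorsionResidualAtTwo` (stmt-BirchSwinnertonDyer-27478) of route GenusKolyvaginAtTwo, LINE 49
«torsion_cell_full_vertex_bsdidea1» (pen bsd-idea-1); companion of `…GenusDepthTwistEigen` (twist points are
`χ_θ`-eigenvectors) and `…GenusDepthPoints` (the (LOW) dictionary on `E(L)`).  For the QUADRATIC layer `K = F(θ)`,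
`[K : F] = 2`, `θ² = c ∈ F`, `θ ∉ F`, `2 ≠ 0` (the case `k = 1`, `K_gen = K″`), and ANY `F`-automorphism `σ` of `K`
with `σ θ = −θ`:

* `exists_eq_algebraMap_of_algHom_apply_eq`, `exists_eq_mul_of_algHom_apply_eq_neg` — `σ x = x ⟹ x ∈ F`,
  `σ x = −x ⟹ x ∈ F·θ` (for any such `σ`; the tree has them for its chosen conjugation `Quadratic.conj`);
* **`exists_incl_eq_of_smul_eq`** — a point of `W^{(1)}(K)` FIXED by `σ` is `F`-rational (`= incl K _ Q`);
* **`exists_twistMap_eq_of_smul_eq_neg`** — a point with `σ • P = −P` is a TWIST POINT: `P = τ R`, `R ∈ W^{(c)}(F)`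
  (`τ = QuadraticDescent.twistMap`), so together with `conjMap_twistMap`: the `(−1)`-eigenvectors of `σ` are EXACTLY
  `τ(W^{(c)}(F))`;
* **`exists_sub_zsmul_twistMap_mem_torsion_of_generator`** — the dictionary's `hsat` at `k = 1`: if `W^{(c)}(F) = ℤ R₀ + tors`
  then every `(−1)`-eigenvector `P` of `σ` satisfies `P − a • τ R₀ ∈ W^{(1)}(K)_tors` for some `a ∈ ℤ`.

Pure algebra of the models (Silverman AEC X.2 / Ex. 10.16); nothing here is a statement of the line, and NOTHING HERE
PROVES R″ or any summit — BSD is not advanced by this file alone.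

## References

* [SilvermanAEC2009] X.2 (proof of Prop. 2.4), X.5 Cor. 5.4, Exercise 10.16.
-/

noncomputable section

open scoped Classical

namespace Summit.BirchSwinnertonDyer.BirchSwinnertonDyer.Theorems.GenusKolyvaginAtTwo.FullVertex.GenusDepth

open WeierstrassCurve WeierstrassCurve.QuadraticDescent Module
open Literature.NumberTheory.QuadraticFields.Quadratic (exists_eq_add_mul ne_zero_of_not_mem_range two_ne_zero')

universe u

variable {F K : Type u} [Field F] [Field K] [Algebra F K] [NeZero (2 : F)]
  (h2 : finrank F K = 2) {θ : K} {c : F} (hθ : θ ∉ Set.range (algebraMap F K)) (hc : θ ^ 2 = algebraMap F K c)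

include h2 hθ in
/-- In `K = F(θ)` (`[K:F] = 2`, `θ ∉ F`, `2 ≠ 0`): an element fixed by an `F`-automorphism `σ` with `σ θ = −θ` lies in `F`.
(The tree's `exists_eq_algebraMap_of_conj_eq` is this for `σ = Quadratic.conj`.) [cite: SilvermanAEC2009, X.2 Prop. 2.4 (proof)] -/
theorem exists_eq_algebraMap_of_algHom_apply_eq {σ : K →ₐ[F] K} (hσ : σ θ = -θ) {x : K} (hx : σ x = x) :
    ∃ a : F, x = algebraMap F K a := by
  obtain ⟨a, b, rfl⟩ := exists_eq_add_mul h2 hθ x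
  rw [map_add, map_mul, AlgHom.commutes, AlgHom.commutes, hσ] at hx
  have h0 : (2 : K) * (algebraMap F K b * θ) = 0 := by linear_combination -hx
  rcases mul_eq_zero.mp h0 with h | h
  · exact absurd h (two_ne_zero' (F := F))
  · exact ⟨a, by rw [h, add_zero]⟩

include h2 hθ in
/-- In `K = F(θ)`: an element negated by an `F`-automorphism `σ` with `σ θ = −θ` lies in `F·θ`.
[cite: SilvermanAEC2009, X.2 Prop. 2.4 (proof)] -/
theorem exists_eq_mul_of_algHom_apply_eq_neg {σ : K →ₐ[F] K} (hσ : σ θ = -θ) {x : K} (hx : σ x = -x) :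
    ∃ b : F, x = algebraMap F K b * θ := by
  obtain ⟨a, b, rfl⟩ := exists_eq_add_mul h2 hθ x
  rw [map_add, map_mul, AlgHom.commutes, AlgHom.commutes, hσ] at hx
  have h0 : (2 : K) * algebraMap F K a = 0 := by linear_combination hx
  rcases mul_eq_zero.mp h0 with h | h
  · exact absurd h (two_ne_zero' (F := F))
  · exact ⟨b, by rw [h, zero_add]⟩

include h2 hθ in
/-- **Fixed points are rational.**  A point of `W^{(1)}(K)` (indeed of any `V(K)`) fixed by an `F`-automorphism `σ` with
`σ θ = −θ` comes from `V(F)`. [cite: SilvermanAEC2009, Exercise 10.16] -/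
theorem exists_incl_eq_of_smul_eq (V : WeierstrassCurve F) {σ : K ≃ₐ[F] K} (hσ : σ θ = -θ)
    (P : (V.baseChange K).toAffine.Point) (hP : σ • P = P) : ∃ Q : V.toAffine.Point, incl K V Q = P := by
  rcases P with _ | ⟨x, y, h⟩
  · exact ⟨0, (map_zero _).trans Affine.Point.zero_def⟩
  · rw [WeierstrassCurve.smul_def, Affine.Point.map_some, Affine.Point.some.injEq] at hP
    have hσ' : (σ : K →ₐ[F] K) θ = -θ := hσ
    obtain ⟨a, ha⟩ := exists_eq_algebraMap_of_algHom_apply_eq h2 hθ hσ' hP.1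
    obtain ⟨b, hb⟩ := exists_eq_algebraMap_of_algHom_apply_eq h2 hθ hσ' hP.2
    exact exists_incl_eq V h ha.symm hb.symm

include h2 in
/-- **Anti-fixed points are twist points.**  A point `P ∈ W^{(1)}(K)` with `σ • P = −P` for an `F`-automorphism `σ` with
`σ θ = −θ` is in the image of the twisting map: `P = τ R` for some `R ∈ W^{(c)}(F)`.  With `conjMap_twistMap` (tree): the
`(−1)`-eigenvectors of `σ` are EXACTLY `τ(W^{(c)}(F))`. [cite: SilvermanAEC2009, Exercise 10.16] -/
theorem exists_twistMap_eq_of_smul_eq_neg (W : WeierstrassCurve F) {σ : K ≃ₐ[F] K} (hσ : σ θ = -θ)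
    (P : ((W.quadraticTwist 1).baseChange K).toAffine.Point) (hP : σ • P = -P) :
    ∃ R : (W.quadraticTwist c).toAffine.Point, twistMap W hθ hc R = P := by
  rcases P with _ | ⟨x, y, h⟩
  · exact ⟨0, (map_zero _).trans Affine.Point.zero_def⟩
  · rw [WeierstrassCurve.smul_def, Affine.Point.map_some, Affine.Point.neg_some, Affine.Point.some.injEq,
      negY_quadraticTwist_one_baseChange] at hP
    have hσ' : (σ : K →ₐ[F] K) θ = -θ := hσ
    obtain ⟨a, ha⟩ := exists_eq_algebraMap_of_algHom_apply_eq h2 hθ hσ' hP.1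
    obtain ⟨b, hb⟩ := exists_eq_mul_of_algHom_apply_eq_neg h2 hθ hσ' hP.2
    exact exists_twistMap_eq W hθ hc h ha.symm hb.symm

include h2 in
/-- **The dictionary's `hsat` at the quadratic layer.**  If `W^{(c)}(F)` is generated by `R₀` up to torsion (rank one), then
every `(−1)`-eigenvector `P` of an `F`-automorphism `σ` with `σ θ = −θ` satisfies `P − a • τ R₀ ∈ W^{(1)}(K)_tors` for some
`a ∈ ℤ` (`τ` is additive and carries torsion to torsion). [cite: SilvermanAEC2009, Exercise 10.16] -/
theorem exists_sub_zsmul_twistMap_mem_torsion_of_generator (W : WeierstrassCurve F) {σ : K ≃ₐ[F] K} (hσ : σ θ = -θ)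
    (R₀ : (W.quadraticTwist c).toAffine.Point)
    (hgen : ∀ R : (W.quadraticTwist c).toAffine.Point,
      ∃ a : ℤ, R - a • R₀ ∈ AddCommGroup.torsion (W.quadraticTwist c).toAffine.Point)
    (P : ((W.quadraticTwist 1).baseChange K).toAffine.Point) (hP : σ • P = -P) :
    ∃ a : ℤ, P - a • twistMap W hθ hc R₀ ∈ AddCommGroup.torsion ((W.quadraticTwist 1).baseChange K).toAffine.Point := by
  obtain ⟨R, rfl⟩ := exists_twistMap_eq_of_smul_eq_neg h2 hθ hc W hσ P hP
  obtain ⟨a, ha⟩ := hgen R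
  refine ⟨a, ?_⟩
  rw [← map_zsmul, ← map_sub]
  rw [AddCommGroup.mem_torsion, isOfFinAddOrder_iff_nsmul_eq_zero] at ha ⊢
  obtain ⟨n, hn, hnR⟩ := ha
  exact ⟨n, hn, by rw [← map_nsmul, hnR, map_zero]⟩

end Summit.BirchSwinnertonDyer.BirchSwinnertonDyer.Theorems.GenusKolyvaginAtTwo.FullVertex.GenusDepth

end
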